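import Summits.CriticalPhenomena.SAWScalingLimit.Theses.SAWTipEnvironment
import Literature.Probability.RandomPlanarGeometry.DrivingFunctionMeasurable

/-!
# Line `birth` — registered skeleton for the crux `CorrectorPassage` (stmt-CriticalPhenomena-16039)

Crux (FIXED; rank 4 of `route-CriticalPhenomena-SAWTipEnvironment`, sub-problem `SAWScalingLimit`): fix
`κ > 0`, a Dobrushin domain `(D; a, b)`, an endpoint approximation and a chordal uniformizer `φ`; if the
corrector property of `MartingaleCorrector` holds at `(D, a, b, φ, κ)` (an exact lattice martingale `M`
for the SAW tip kernel, `ε`-close to the half-plane driving values `ξ_η = LatticeSlit.drivingValue φ η`,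
with predictable bracket `≈ κ · capTime` and jumps `≤ ε`, on all prefixes of capacity `≤ T`, with
probability `≥ 1 − ε`, for all small `δ`), then for every probability subsequential limit law `ν` of the SAW
curve laws that is `ν`-a.e. Loewner-describable from `a`, the driving function `W = drivingFunction φ`
satisfies the stopped cylinder martingale identities of `W` and `W² − κt` (all integer levels `m`).

## The cut — driver tightness ▸ identification of the limit's driving process ▸ stopped passage

The route's own foreseen split ("CorrectorPassage ⇐ DrivingValuesConverge → UniformIntegrability", route
header TWO-LAYER PLAN) typed against the tree, with the grounder's gap analysis built in (grounder g51-6 on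
stmt-16039: every passage engine of the tree — `Loewner.integral_cylinder_eq_zero_of_discreteMartingales`,
`…_of_tendstoInDistribution`, the KS fact `exists_regularity_of_conditionG2` — needs CONVERGENCE IN LAW OF
THE DRIVING PROCESSES to `W` under `ν`, which the crux does not assume; `c ↦ drivingFunction φ c` is not
continuous on `CurveClass ℂ` and is junk on lattice curves, which start at the interior point `δ a_δ`).
The lattice driving process is therefore carried by the stem-attached coordinates of
`LatticeSlitIncrements` (`capTime`, `drivingValue` of the prefixes `γ.walk.take k`), interpolated to a
continuous path `V n γ ∈ C([0, ∞), ℝ)` whose only specification is the interpolation property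
`Interpolates` (knot values within `ε`, oscillation `≤ ε` between knots, in probability) — the idiom of
`SkorokhodEmbedding.DrivingData.drv_at / drv_osc` of the tree's LSW §3.3 engine.

* S1 `stub_driverTightness` (size M–L, pure martingale inequalities): the corrector ⇒ asymptotic
  equicontinuity in capacity time of `k ↦ ξ_k`, in probability, eventually in `δ` (`DriverTight`).
* S2 `stub_drivingConvergence` (HARDEST, size XL — the crux's recorded why-might-fail lives here and only
  here): `DriverTight` + weak convergence of the curve laws along `s_n → 0⁺` to a probability law `ν` +
  `ν`-a.e. describability from `a` ⇒ an interpolation `V` with `(γ.curve, V) → (c, W(c))` in law on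
  `CurveClass ℂ × C([0, ∞), ℝ)` (`JointDrivingConvergence`; KS Thm. 1.5 (iii) / Cor. 1.7 for the SAW, the
  driver-modulus event coming from S1 and Loewner regularity of the limit from the hypothesis rather than
  from Condition G2). `κ`-free.
* S3 `stub_stoppedPassage` (size L): the corrector + `Interpolates` + convergence in law of `V` to `W(ν)`
  (`DrivingLawConvergence`, the marginal of S2) ⇒ the stopped cylinder identities (`CylinderIdentities`):
  Doob optional sampling for the exact lattice martingale and its compensated square, bounded stopped
  values, `ν`-a.s. continuity of the hitting functional at a.e. level, almost-continuous mapping, `m' ↑ m`.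

`CorrectorPassage_of` (kernel-checked, no `sorry` of its own) does the bookkeeping between the crux's
`IsSubseqLimitLaw` and the stubs' sequence form: it extracts the mesh sequence, proves that the SAW laws
along it are EVENTUALLY probability measures (`SAW.law ∈ {0, probability}` and `∫ 1 dP_(s n) → 1`), shifts
the sequence past the junk terms, chains S1 → S2, projects the joint convergence to the driving-path
marginal (`TendstoInDistribution.continuous_comp continuous_snd`) and applies S3; it concludes the route
decl BY NAME through `correctorPassage_iff : CorrectorPassage' ↔ CorrectorPassage := Iff.rfl`.

Disproof / negatives used: no `Cruxes/CorrectorPassage/Disproof.lean` exists (`ledger crux ls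
stmt-CriticalPhenomena-16039`: no workfiles, 2026-08-17), so there is no `_false_without_` obstruction to
honour and no landed `Theorems/CorrectorPassage/Negative/*`; `ledger negatives --problem CriticalPhenomena`:
the SAW entries concern ALL-`δ` tightness (stmt-0772, refuted because `SAW.law` is junk for large `δ`) — every
statement below is eventual in `δ`, or along a mesh sequence with the probability of the laws as an explicit
hypothesis, and `CorrectorPassage_of` derives that hypothesis instead of assuming it.
Vacuity pass: `Interpolates`/`DriverTight` couple "probability `≤ ε`" with "deviation `≤ ε`" (one `ε`, as
the route's `MartingaleCorrector` does); `Interpolates` at `u = t_(k+1)` forces `|ξ_(k+1) − ξ_k| ≤ 2ε` below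
capacity `T` w.h.p. — true under `DriverTight` (flat steps `t_(k+1) = t_k` included), so S2's `∃ V` is
inhabited by the piecewise-linear interpolation in the intended regime and by nothing lattice-blind (the
knot clause pins `V` to `ξ`); S3's extra hypotheses are exactly S2's output, so S3 is strictly weaker than the
crux, and S1's conclusion is not implied by the crux. BC3 probes (stub → crux, stub → `SAWScalingLimit`, by
`first | exact? | simpa | simpa [Stub] | (unfold Stub; simpa) | aesop`): all FAIL — see `Lines/birth.md`.
-/

noncomputable section

-- the route file's scopes, re-opened verbatim so that the crux's `let`/`if`/coercion elaboration coincides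
-- with §1 below and `correctorPassage_iff` is `Iff.rfl`; `PathBorel` = the tree's Borel structure on `C(ℝ≥0, ℝ)`
open scoped BigOperators Topology Manifold Classical MeasureTheory ProbabilityTheory Matrix InnerProductSpace ComplexConjugate ContinuousMap
open Filter Set Function TopologicalSpace MeasureTheory
open scoped Literature.Probability.RandomPlanarGeometry.PathBorel

namespace Summit.CriticalPhenomena.SAWScalingLimit.Cruxes.CorrectorPassage.Birth

/-! ### 1. Vocabulary — the crux's hypothesis and conclusion by name, and the three intermediate notions -/

/-- **The corrector property at `(κ; D, a, b, φ)`** — VERBATIM the hypothesis of the crux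
`CorrectorPassage` (= the conclusion of `MartingaleCorrector` at one marked domain): for every horizon `T`
and `ε > 0`, for all small `δ`, an EXACT martingale `M` of the lattice prefix for the SAW tip kernel
`p(u|η) = x_c Z_{ηu}(b_δ)/Z_η(b_δ)` up to capacity time `T`, with, outside an event of `SAW.law`-mass `≤ ε`,
`|M(η) − ξ_η| ≤ ε`, predictable bracket within `ε` of `κ · capTime η`, and jumps `≤ ε`, simultaneously for all
prefixes `η` of capacity `≤ T`. -/
def CorrectorHyp (κ : NNReal) (D : Literature.Probability.RandomPlanarGeometry.DobrushinDomain) (a b : ℝ → Literature.Probability.LatticeModels.Site 2) (φ : Literature.Probability.RandomPlanarGeometry.ConformalEquiv UpperHalfPlane.upperHalfPlaneSet D.carrier) : Prop :=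
  (∀ (T ε : ℝ), 0 < T → 0 < ε → ∀ᶠ δ in nhdsWithin 0 (Set.Ioi 0), let Z : Literature.Probability.LatticeModels.Site 2 → List (Literature.Probability.LatticeModels.Site 2) → ℝ := fun w S => ∑' ω : Literature.Probability.RandomPlanarGeometry.SAW.DomainSAW D.carrier δ w (b δ), if ∀ v ∈ ω.walk.support.tail, v ∉ S then Literature.Probability.RandomPlanarGeometry.SAW.criticalFugacity ^ ω.length else 0; let p : List (Literature.Probability.LatticeModels.Site 2) → Literature.Probability.LatticeModels.Site 2 → Literature.Probability.LatticeModels.Site 2 → ℝ := fun S w u => Literature.Probability.RandomPlanarGeometry.SAW.criticalFugacity * Z u (S ++ [u]) / Z w S; ∃ M : List (Literature.Probability.LatticeModels.Site 2) → ℝ, (∀ (γ : Literature.Probability.RandomPlanarGeometry.SAW.DomainSAW D.carrier δ (a δ) (b δ)) (n : ℕ), n < γ.length → Literature.Probability.RandomPlanarGeometry.LatticeSlit.capTime φ (γ.walk.take n) ≤ T → M (γ.walk.take n).support = ∑ᶠ u ∈ {u | (Literature.Probability.LatticeModels.discreteDomainGraph D.carrier δ).Adj (γ.walk.getVert n) u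 ∧ u ∉ (γ.walk.take n).support}, p (γ.walk.take n).support (γ.walk.getVert n) u * M ((γ.walk.take n).support ++ [u])) ∧ Literature.Probability.RandomPlanarGeometry.SAW.law D.carrier δ (a δ) (b δ) {γ | ∃ n : ℕ, n ≤ γ.length ∧ Literature.Probability.RandomPlanarGeometry.LatticeSlit.capTime φ (γ.walk.take n) ≤ T ∧ (ε < |M (γ.walk.take n).support - Literature.Probability.RandomPlanarGeometry.LatticeSlit.drivingValue φ (γ.walk.take n)| ∨ ε < |(∑ k ∈ Finset.range n, ∑ᶠ u ∈ {u | (Literature.Probability.LatticeModels.discreteDomainGraph D.carrier δ).Adj (γ.walk.getVert k) u ∧ u ∉ (γ.walk.take k).support}, p (γ.walk.take k).support (γ.walk.getVert k) u * (M ((γ.walk.take k).support ++ [u]) - M (γ.walk.take k).support) ^ 2) - (κ : ℝ) * Literature.Probability.RandomPlanarGeometry.LatticeSlit.capTime φ (γ.walk.take n)| ∨ (n < γ.length ∧ ε < |M (γ.walk.take (n + 1)).support - M (γ.walk.take n).support|))} ≤ ENNReal.ofReal ε)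

/-- **The stopped cylinder martingale identities of `W = drivingFunction φ` and `W² − κt` under `ν`** —
VERBATIM the conclusion of the crux `CorrectorPassage` (and the hypothesis of the route's support item
`DrivingIdentification`): `E_ν[(W_(t∧τ_m) − W_(s∧τ_m)) ψ(W_S)] = 0` and the same for `W² − κ·`, for all
`m`, `s ≤ t`, times `S ≤ s` and continuous `|ψ| ≤ 1`, `τ_m = inf {t : |W_t| ≥ m} ∧ m`. -/
def CylinderIdentities (κ : NNReal) (D : Literature.Probability.RandomPlanarGeometry.DobrushinDomain)
    (φ : Literature.Probability.RandomPlanarGeometry.ConformalEquiv UpperHalfPlane.upperHalfPlaneSet D.carrier)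
    (ν : MeasureTheory.Measure (Literature.Probability.RandomPlanarGeometry.CurveClass ℂ)) : Prop :=
  let W : Literature.Probability.RandomPlanarGeometry.CurveClass ℂ → NNReal → ℝ := fun c => Literature.Probability.RandomPlanarGeometry.drivingFunction φ c; let τ : ℕ → Literature.Probability.RandomPlanarGeometry.CurveClass ℂ → NNReal := fun m c => sInf ({t : NNReal | (m : ℝ) ≤ |W c t|} ∪ {(m : NNReal)}); ∀ (m : ℕ) (s t : NNReal), s ≤ t → ∀ (n : ℕ) (S : Fin n → NNReal), (∀ k, S k ≤ s) → ∀ ψ : (Fin n → ℝ) → ℝ, Continuous ψ → (∀ v, |ψ v| ≤ 1) → (∫ c, (W c (min t (τ m c)) - W c (min s (τ m c))) * ψ (fun k => W c (S k)) ∂ν = 0) ∧ (∫ c, ((W c (min t (τ m c))) ^ 2 - (κ : ℝ) * ((min t (τ m c) : NNReal) : ℝ) - ((W c (min s (τ m c))) ^ 2 - (κ : ℝ) * ((min s (τ m c) : NNReal) : ℝ))) * ψ (fun k => W c (S k)) ∂ν = 0)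

/-- **Asymptotic equicontinuity, in capacity time and in probability, of the lattice driving values**
`ξ_k = drivingValue φ (γ.walk.take k)` along the prefixes of the critical SAW (knots at the capacity times
`t_k = capTime φ (γ.walk.take k)`, nondecreasing in `k`): for every horizon `T`, gauge `η > 0` and `ε > 0`
there is a window `θ > 0` such that, for all small `δ`, with `SAW.law`-probability `≥ 1 − ε` no two prefixes
`j ≤ k` with `t_k ≤ T` and `t_k − t_j ≤ θ` have `|ξ_k − ξ_j| > η`. (The shape of the driver-modulus event
`E_3` of Kemppainen–Smirnov 2017, §3.5, here to be extracted from the corrector's martingale.) -/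
def DriverTight (D : Literature.Probability.RandomPlanarGeometry.DobrushinDomain) (a b : ℝ → Literature.Probability.LatticeModels.Site 2) (φ : Literature.Probability.RandomPlanarGeometry.ConformalEquiv UpperHalfPlane.upperHalfPlaneSet D.carrier) : Prop :=
  ∀ (T η ε : ℝ), 0 < T → 0 < η → 0 < ε → ∃ θ : ℝ, 0 < θ ∧ ∀ᶠ δ in nhdsWithin (0 : ℝ) (Set.Ioi 0),
    Literature.Probability.RandomPlanarGeometry.SAW.law D.carrier δ (a δ) (b δ)
      {γ | ∃ j k : ℕ, j ≤ k ∧ k ≤ γ.length ∧ Literature.Probability.RandomPlanarGeometry.LatticeSlit.capTime φ (γ.walk.take k) ≤ T ∧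
        Literature.Probability.RandomPlanarGeometry.LatticeSlit.capTime φ (γ.walk.take k) ≤ Literature.Probability.RandomPlanarGeometry.LatticeSlit.capTime φ (γ.walk.take j) + θ ∧
        η < |Literature.Probability.RandomPlanarGeometry.LatticeSlit.drivingValue φ (γ.walk.take k) - Literature.Probability.RandomPlanarGeometry.LatticeSlit.drivingValue φ (γ.walk.take j)|} ≤ ENNReal.ofReal ε

/-- **`V` interpolates the lattice driving values along the mesh sequence `s`**: `V n γ ∈ C([0, ∞), ℝ)` is a
continuous path attached to the SAW `γ` at mesh `s n` such that for every horizon `T` and `ε > 0`, for all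
large `n`, outside an event of `SAW.law`-mass `≤ ε`: for every prefix `k ≤ |γ|` with `t_k ≤ T`, the path
stays within `ε` of `ξ_k` on the knot interval `[t_k, t_(k+1)]` (read `[0, t_1]` for `k = 0` — the stem's
capacity `t_0 → 0` — and `[t_k, ∞)` for the terminal prefix `k = |γ|`). Any continuous interpolation of the
knots `(t_k, ξ_k)` qualifies once consecutive driving jumps are small (which `DriverTight` provides). -/
def Interpolates (D : Literature.Probability.RandomPlanarGeometry.DobrushinDomain) (a b : ℝ → Literature.Probability.LatticeModels.Site 2) (φ : Literature.Probability.RandomPlanarGeometry.ConformalEquiv UpperHalfPlane.upperHalfPlaneSet D.carrier) (s : ℕ → ℝ) (V : (n : ℕ) → Literature.Probability.RandomPlanarGeometry.SAW.DomainSAW D.carrier (s n) (a (s n)) (b (s n)) → C(NNReal, ℝ)) : Prop :=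
  ∀ (T ε : ℝ), 0 < T → 0 < ε → ∀ᶠ n in Filter.atTop,
    Literature.Probability.RandomPlanarGeometry.SAW.law D.carrier (s n) (a (s n)) (b (s n))
      {γ | ∃ k : ℕ, k ≤ γ.length ∧ Literature.Probability.RandomPlanarGeometry.LatticeSlit.capTime φ (γ.walk.take k) ≤ T ∧
        ∃ u : NNReal, (0 < k → Literature.Probability.RandomPlanarGeometry.LatticeSlit.capTime φ (γ.walk.take k) ≤ (u : ℝ)) ∧
          (k < γ.length → (u : ℝ) ≤ Literature.Probability.RandomPlanarGeometry.LatticeSlit.capTime φ (γ.walk.take (k + 1))) ∧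
          ε < |V n γ u - Literature.Probability.RandomPlanarGeometry.LatticeSlit.drivingValue φ (γ.walk.take k)|} ≤ ENNReal.ofReal ε

/-- **Joint convergence in law of (curve, interpolated lattice driving path) to `(c, W(c))` under `ν`**
along the mesh sequence `s` — Kemppainen–Smirnov's Thm. 1.5 (iii) / Cor. 1.7 conclusion in the tree's
`TendstoInDistribution` form on `CurveClass ℂ × C([0, ∞), ℝ)` (cf.
`tendstoInDistribution_prodMk_drivingPath_of_forall_exists_isClosed`, whose lattice-side driving functional
is replaced here by the stem-attached lattice driving values of `LatticeSlitIncrements`). -/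
def JointDrivingConvergence (D : Literature.Probability.RandomPlanarGeometry.DobrushinDomain) (a b : ℝ → Literature.Probability.LatticeModels.Site 2) (φ : Literature.Probability.RandomPlanarGeometry.ConformalEquiv UpperHalfPlane.upperHalfPlaneSet D.carrier) (s : ℕ → ℝ)
    [∀ n, MeasureTheory.IsProbabilityMeasure (Literature.Probability.RandomPlanarGeometry.SAW.law D.carrier (s n) (a (s n)) (b (s n)))]
    (V : (n : ℕ) → Literature.Probability.RandomPlanarGeometry.SAW.DomainSAW D.carrier (s n) (a (s n)) (b (s n)) → C(NNReal, ℝ)) (ν : MeasureTheory.Measure (Literature.Probability.RandomPlanarGeometry.CurveClass ℂ))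
    [MeasureTheory.IsProbabilityMeasure ν] : Prop :=
  MeasureTheory.TendstoInDistribution (fun n (γ : Literature.Probability.RandomPlanarGeometry.SAW.DomainSAW D.carrier (s n) (a (s n)) (b (s n))) => (γ.curve, V n γ)) Filter.atTop
    (fun c : Literature.Probability.RandomPlanarGeometry.CurveClass ℂ => (c, (⟨Literature.Probability.RandomPlanarGeometry.drivingFunction φ c, Literature.Probability.RandomPlanarGeometry.continuous_drivingFunction φ c⟩ : C(NNReal, ℝ))))
    (fun n => Literature.Probability.RandomPlanarGeometry.SAW.law D.carrier (s n) (a (s n)) (b (s n))) ν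

/-- **Convergence in law of the interpolated lattice driving paths to the driving function of `ν`** in
`C([0, ∞), ℝ)` (the second marginal of `JointDrivingConvergence`) — exactly the hypothesis `hlaw` of the
tree's passage engine `Loewner.integral_cylinder_eq_zero_of_discreteMartingales`. -/
def DrivingLawConvergence (D : Literature.Probability.RandomPlanarGeometry.DobrushinDomain) (a b : ℝ → Literature.Probability.LatticeModels.Site 2) (φ : Literature.Probability.RandomPlanarGeometry.ConformalEquiv UpperHalfPlane.upperHalfPlaneSet D.carrier) (s : ℕ → ℝ)
    [∀ n, MeasureTheory.IsProbabilityMeasure (Literature.Probability.RandomPlanarGeometry.SAW.law D.carrier (s n) (a (s n)) (b (s n)))]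
    (V : (n : ℕ) → Literature.Probability.RandomPlanarGeometry.SAW.DomainSAW D.carrier (s n) (a (s n)) (b (s n)) → C(NNReal, ℝ)) (ν : MeasureTheory.Measure (Literature.Probability.RandomPlanarGeometry.CurveClass ℂ))
    [MeasureTheory.IsProbabilityMeasure ν] : Prop :=
  MeasureTheory.TendstoInDistribution (fun n (γ : Literature.Probability.RandomPlanarGeometry.SAW.DomainSAW D.carrier (s n) (a (s n)) (b (s n))) => V n γ) Filter.atTop
    (fun c : Literature.Probability.RandomPlanarGeometry.CurveClass ℂ => (⟨Literature.Probability.RandomPlanarGeometry.drivingFunction φ c, Literature.Probability.RandomPlanarGeometry.continuous_drivingFunction φ c⟩ : C(NNReal, ℝ)))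
    (fun n => Literature.Probability.RandomPlanarGeometry.SAW.law D.carrier (s n) (a (s n)) (b (s n))) ν

/-! ### 2. The three statements of the line and the crux in this vocabulary -/

/-- **S1 (stub_driverTightness) — driver equicontinuity from the corrector.** At every `(κ; D, a, b, φ)`
where the corrector property holds, the lattice driving values are asymptotically equicontinuous in
capacity time (`DriverTight`). Martingale maximal-inequality work: off the corrector's bad event `ξ` is
within `ε` of an exact martingale `M` with jumps `≤ ε` whose predictable bracket over a capacity window of
length `θ` is `≤ κθ + 2ε`; a fourth-moment Burkholder / Freedman bound per window and a union over
`O(T/θ)` windows give `P(osc > η) ≲ T κ² θ / η⁴ → 0`. Size M–L. -/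
def DriverTightness : Prop :=
  ∀ (κ : NNReal) (D : Literature.Probability.RandomPlanarGeometry.DobrushinDomain) (a b : ℝ → Literature.Probability.LatticeModels.Site 2) (φ : Literature.Probability.RandomPlanarGeometry.ConformalEquiv UpperHalfPlane.upperHalfPlaneSet D.carrier),
      0 < κ → Literature.Probability.RandomPlanarGeometry.SAW.IsEndpointApprox D a b → D.IsChordalUniformizing φ → CorrectorHyp κ D a b φ →
      DriverTight D a b φ

/-- **S2 (stub_drivingConvergence, HARDEST) — identification of the driving process of the limit
(Kemppainen–Smirnov Thm. 1.5 (iii) for the SAW, with driver tightness in place of Condition G2).** If the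
lattice drivers are equicontinuous in probability (`DriverTight`), then along every mesh sequence `s_n → 0⁺`
on which the SAW curve laws are probability measures converging weakly to a law `ν` that is `ν`-a.e.
Loewner-describable from `a`, some continuous interpolation `V` of the lattice driving values converges in
law, JOINTLY with the curve, to `(c, drivingFunction φ c)` under `ν`. Route of proof: tightness of
`(γ, V)` (curves converge; drivers equicontinuous, `ξ_0, t_0 → 0` by `hab`, `hφ`); for a joint
subsequential limit `(c, w)`, Hausdorff convergence of the stem-attached lattice traces gives Carathéodory
convergence of the capacity-parametrised hulls (`hcap` and the Laurent coefficient `a_2(t) = 2∫_0^t U` are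
Carathéodory-continuous on uniformly bounded hulls), so `∫_0^t w = ∫_0^t W(c)` and `w = W(c)` — KS Lemma A.5
with the describability of the limit ASSUMED (`LimitsDescribable`) instead of derived. This is where the
crux's recorded why-might-fail lives (no uniform G2/pairBox input; boundary-creeping prefixes of small
capacity must be shown improbable from the describability of `ν`). Size XL. -/
def DrivingConvergence : Prop :=
  ∀ (D : Literature.Probability.RandomPlanarGeometry.DobrushinDomain) (a b : ℝ → Literature.Probability.LatticeModels.Site 2) (φ : Literature.Probability.RandomPlanarGeometry.ConformalEquiv UpperHalfPlane.upperHalfPlaneSet D.carrier),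
      Literature.Probability.RandomPlanarGeometry.SAW.IsEndpointApprox D a b → D.IsChordalUniformizing φ → DriverTight D a b φ →
      ∀ (ν : MeasureTheory.Measure (Literature.Probability.RandomPlanarGeometry.CurveClass ℂ)) (hν : MeasureTheory.IsProbabilityMeasure ν),
      ∀ s : ℕ → ℝ, Filter.Tendsto s Filter.atTop (nhdsWithin (0 : ℝ) (Set.Ioi 0)) →
      ∀ (hP : ∀ n, MeasureTheory.IsProbabilityMeasure (Literature.Probability.RandomPlanarGeometry.SAW.law D.carrier (s n) (a (s n)) (b (s n)))),
      (∀ f : BoundedContinuousFunction (Literature.Probability.RandomPlanarGeometry.CurveClass ℂ) ℝ,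
        Filter.Tendsto (fun n => ∫ γ, f γ.curve ∂(Literature.Probability.RandomPlanarGeometry.SAW.law D.carrier (s n) (a (s n)) (b (s n)))) Filter.atTop (nhds (∫ c, f c ∂ν))) →
      (∀ᵐ c ∂ν, Literature.Probability.RandomPlanarGeometry.IsLoewnerDescribable φ c ∧ c.source = D.pt 0) →
      ∃ V : (n : ℕ) → Literature.Probability.RandomPlanarGeometry.SAW.DomainSAW D.carrier (s n) (a (s n)) (b (s n)) → C(NNReal, ℝ),
        Interpolates D a b φ s V ∧ JointDrivingConvergence D a b φ s V ν

/-- **S3 (stub_stoppedPassage) — optional stopping and passage of the stopped identities to the limit.**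
At `(κ; D, a, b, φ)` with the corrector property, for a probability law `ν` and a mesh sequence along which
an interpolation `V` of the lattice driving values converges in law to `drivingFunction φ` under `ν`, the
stopped cylinder identities of `W` and `W² − κt` hold under `ν` for every integer level `m`. Lattice side:
the exact martingale `M` of the corrector (a genuine `SAW.law`-martingale of the prefix filtration by the
slit first-step identity), stopped at the first prefix of capacity `≥ s`, `≥ t` or with `|M| ≥ m'`, gives
`E[(M_τ − M_σ) ψ(ξ_S)] = 0` and `E[((M² − bracket)_τ − (M² − bracket)_σ) ψ(ξ_S)] = 0` with bounded stopped
values (Doob, `Process.integral_stoppedValue_sub_mul_cylinder_eq_zero`); limit side: the hitting functional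
`τ_(m')` is `ν`-a.s. continuous at Lebesgue-a.e. level `m'` (monotonicity in the level), so the stopped
functionals pass to the limit along `DrivingLawConvergence` (almost-continuous mapping, as in
`Loewner.integral_cylinder_eq_zero_of_tendstoInDistribution` but for discontinuous bounded functionals), and
integer levels `m` follow from `m' ↑ m` by `τ_(m') ↑ τ_m` and bounded convergence. Size L. -/
def StoppedPassage : Prop :=
  ∀ (κ : NNReal) (D : Literature.Probability.RandomPlanarGeometry.DobrushinDomain) (a b : ℝ → Literature.Probability.LatticeModels.Site 2) (φ : Literature.Probability.RandomPlanarGeometry.ConformalEquiv UpperHalfPlane.upperHalfPlaneSet D.carrier),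
      0 < κ → Literature.Probability.RandomPlanarGeometry.SAW.IsEndpointApprox D a b → D.IsChordalUniformizing φ → CorrectorHyp κ D a b φ →
      ∀ (ν : MeasureTheory.Measure (Literature.Probability.RandomPlanarGeometry.CurveClass ℂ)) (hν : MeasureTheory.IsProbabilityMeasure ν),
      ∀ s : ℕ → ℝ, Filter.Tendsto s Filter.atTop (nhdsWithin (0 : ℝ) (Set.Ioi 0)) →
      ∀ (hP : ∀ n, MeasureTheory.IsProbabilityMeasure (Literature.Probability.RandomPlanarGeometry.SAW.law D.carrier (s n) (a (s n)) (b (s n)))),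
      ∀ V : (n : ℕ) → Literature.Probability.RandomPlanarGeometry.SAW.DomainSAW D.carrier (s n) (a (s n)) (b (s n)) → C(NNReal, ℝ),
        Interpolates D a b φ s V → DrivingLawConvergence D a b φ s V ν → CylinderIdentities κ D φ ν

/-- The crux `CorrectorPassage` with its corrector hypothesis and its conclusion folded into the §1 names
(definitionally the route decl, `correctorPassage_iff`). -/
def CorrectorPassage' : Prop :=
  ∀ (κ : NNReal) (D : Literature.Probability.RandomPlanarGeometry.DobrushinDomain) (a b : ℝ → Literature.Probability.LatticeModels.Site 2) (φ : Literature.Probability.RandomPlanarGeometry.ConformalEquiv UpperHalfPlane.upperHalfPlaneSet D.carrier),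
      0 < κ → Literature.Probability.RandomPlanarGeometry.SAW.IsEndpointApprox D a b → D.IsChordalUniformizing φ → CorrectorHyp κ D a b φ →
      ∀ ν : MeasureTheory.Measure (Literature.Probability.RandomPlanarGeometry.CurveClass ℂ), MeasureTheory.IsProbabilityMeasure ν →
      Literature.Probability.RandomPlanarGeometry.IsSubseqLimitLaw (fun δ (γ : Literature.Probability.RandomPlanarGeometry.SAW.DomainSAW D.carrier δ (a δ) (b δ)) => γ.curve)
        (fun δ => Literature.Probability.RandomPlanarGeometry.SAW.law D.carrier δ (a δ) (b δ)) ν →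
      (∀ᵐ c ∂ν, Literature.Probability.RandomPlanarGeometry.IsLoewnerDescribable φ c ∧ c.source = D.pt 0) →
      CylinderIdentities κ D φ ν

/-- `CorrectorPassage'` IS the route's crux, definitionally (same text, same scopes). -/
theorem correctorPassage_iff :
    CorrectorPassage' ↔ Summit.CriticalPhenomena.SAWScalingLimit.Theses.SAWTipEnvironment.CorrectorPassage :=
  Iff.rfl

/-! ### 3. The registered stubs (the ONLY `sorry`s of this file) -/

/-- **S1 — driver equicontinuity from the corrector** (`DriverTightness`, size M–L): the corrector's exact
martingale `M` (jumps `≤ ε`, bracket `≈ κ · capTime`) is `ε`-close to the lattice driving values on all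
prefixes of capacity `≤ T`, so a martingale oscillation bound over capacity windows of length `θ` makes
`k ↦ ξ_k` equicontinuous in capacity time with high `SAW.law`-probability, eventually in `δ`. -/
theorem stub_driverTightness :
    ∀ (κ : NNReal) (D : Literature.Probability.RandomPlanarGeometry.DobrushinDomain) (a b : ℝ → Literature.Probability.LatticeModels.Site 2) (φ : Literature.Probability.RandomPlanarGeometry.ConformalEquiv UpperHalfPlane.upperHalfPlaneSet D.carrier),
      0 < κ → Literature.Probability.RandomPlanarGeometry.SAW.IsEndpointApprox D a b → D.IsChordalUniformizing φ → CorrectorHyp κ D a b φ →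
      DriverTight D a b φ := by
  sorry

/-- **S2 (HARDEST) — the driving process of the limit is the limit of the lattice driving processes**
(`DrivingConvergence`, size XL): Kemppainen–Smirnov Thm. 1.5 (iii) / Cor. 1.7 for the critical SAW read
through the stem-attached half-plane coordinates of `LatticeSlitIncrements`, with the driver-modulus event
supplied by `DriverTight` and the Loewner regularity of the limit supplied by the describability hypothesis
(the route's `LimitsDescribable`) instead of Condition G2. -/
theorem stub_drivingConvergence :
    ∀ (D : Literature.Probability.RandomPlanarGeometry.DobrushinDomain) (a b : ℝ → Literature.Probability.LatticeModels.Site 2) (φ : Literature.Probability.RandomPlanarGeometry.ConformalEquiv UpperHalfPlane.upperHalfPlaneSet D.carrier),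
      Literature.Probability.RandomPlanarGeometry.SAW.IsEndpointApprox D a b → D.IsChordalUniformizing φ → DriverTight D a b φ →
      ∀ (ν : MeasureTheory.Measure (Literature.Probability.RandomPlanarGeometry.CurveClass ℂ)) (hν : MeasureTheory.IsProbabilityMeasure ν),
      ∀ s : ℕ → ℝ, Filter.Tendsto s Filter.atTop (nhdsWithin (0 : ℝ) (Set.Ioi 0)) →
      ∀ (hP : ∀ n, MeasureTheory.IsProbabilityMeasure (Literature.Probability.RandomPlanarGeometry.SAW.law D.carrier (s n) (a (s n)) (b (s n)))),
      (∀ f : BoundedContinuousFunction (Literature.Probability.RandomPlanarGeometry.CurveClass ℂ) ℝ,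
        Filter.Tendsto (fun n => ∫ γ, f γ.curve ∂(Literature.Probability.RandomPlanarGeometry.SAW.law D.carrier (s n) (a (s n)) (b (s n)))) Filter.atTop (nhds (∫ c, f c ∂ν))) →
      (∀ᵐ c ∂ν, Literature.Probability.RandomPlanarGeometry.IsLoewnerDescribable φ c ∧ c.source = D.pt 0) →
      ∃ V : (n : ℕ) → Literature.Probability.RandomPlanarGeometry.SAW.DomainSAW D.carrier (s n) (a (s n)) (b (s n)) → C(NNReal, ℝ),
        Interpolates D a b φ s V ∧ JointDrivingConvergence D a b φ s V ν := by
  sorry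

/-- **S3 — optional stopping + passage of the stopped cylinder identities to the weak limit**
(`StoppedPassage`, size L): Doob's optional sampling for the corrector's exact lattice martingale (and for
`M² −` bracket), bounded stopped values, `ν`-a.s. continuity of the level-`m'` hitting functional at a.e.
level, almost-continuous mapping along `DrivingLawConvergence`, and `m' ↑ m`. -/
theorem stub_stoppedPassage :
    ∀ (κ : NNReal) (D : Literature.Probability.RandomPlanarGeometry.DobrushinDomain) (a b : ℝ → Literature.Probability.LatticeModels.Site 2) (φ : Literature.Probability.RandomPlanarGeometry.ConformalEquiv UpperHalfPlane.upperHalfPlaneSet D.carrier),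
      0 < κ → Literature.Probability.RandomPlanarGeometry.SAW.IsEndpointApprox D a b → D.IsChordalUniformizing φ → CorrectorHyp κ D a b φ →
      ∀ (ν : MeasureTheory.Measure (Literature.Probability.RandomPlanarGeometry.CurveClass ℂ)) (hν : MeasureTheory.IsProbabilityMeasure ν),
      ∀ s : ℕ → ℝ, Filter.Tendsto s Filter.atTop (nhdsWithin (0 : ℝ) (Set.Ioi 0)) →
      ∀ (hP : ∀ n, MeasureTheory.IsProbabilityMeasure (Literature.Probability.RandomPlanarGeometry.SAW.law D.carrier (s n) (a (s n)) (b (s n)))),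
      ∀ V : (n : ℕ) → Literature.Probability.RandomPlanarGeometry.SAW.DomainSAW D.carrier (s n) (a (s n)) (b (s n)) → C(NNReal, ℝ),
        Interpolates D a b φ s V → DrivingLawConvergence D a b φ s V ν → CylinderIdentities κ D φ ν := by
  sorry

/-! ### Consistency: each named statement IS its registered stub (definitionally) -/

theorem driverTightness_holds : DriverTightness := stub_driverTightness
theorem drivingConvergence_holds : DrivingConvergence := stub_drivingConvergence
theorem stoppedPassage_holds : StoppedPassage := stub_stoppedPassage

/-! ### Name-keyed aliases of the three statements — the hypotheses of `CorrectorPassage_of`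

The native skeleton audit (`#h21_check_skeleton`) admits a `Prop` hypothesis of the skeleton theorem only if
its head constant is a registered obligation or is NAMED like a declared stub; `__Registered.stub_X` is the
statement of `stub_X` under that name (device of `Cruxes/AxiomsOfLimit/Lines/birth.lean` and
`Cruxes/AsymptoticMorera/Lines/birth.lean`). Each alias is `rfl`-equal to its statement. -/
namespace __Registered

/-- Alias of `DriverTightness` keyed by the registered stub name. -/
abbrev stub_driverTightness : Prop := DriverTightness
/-- Alias of `DrivingConvergence` keyed by the registered stub name. -/
abbrev stub_drivingConvergence : Prop := DrivingConvergence
/-- Alias of `StoppedPassage` keyed by the registered stub name. -/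
abbrev stub_stoppedPassage : Prop := StoppedPassage

end __Registered

/-! ### 4. The sorry-free part: the SAW law along a subsequence, and the composition -/

/-- **The critical SAW law is the zero measure or a probability measure**: it is the weight measure divided
by its total mass, and the `ENNReal` conventions `0⁻¹ · 0 = 0`, `∞⁻¹ · ∞ = 0` cover the two junk cases (no
walk from `a` to `b` in `Ω_δ`; infinite total weight). -/
theorem saw_law_univ_eq_zero_or_isProbabilityMeasure (Ω : Set ℂ) (δ : ℝ) (u v : Literature.Probability.LatticeModels.Site 2) :
    Literature.Probability.RandomPlanarGeometry.SAW.law Ω δ u v Set.univ = 0 ∨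
      MeasureTheory.IsProbabilityMeasure (Literature.Probability.RandomPlanarGeometry.SAW.law Ω δ u v) := by
  by_cases h0 : Literature.Probability.RandomPlanarGeometry.SAW.weight Ω δ u v Set.univ = 0
  · left
    rw [Literature.Probability.RandomPlanarGeometry.SAW.law, MeasureTheory.Measure.smul_apply, smul_eq_mul, h0, mul_zero]
  · by_cases htop : Literature.Probability.RandomPlanarGeometry.SAW.weight Ω δ u v Set.univ = ⊤
    · left
      rw [Literature.Probability.RandomPlanarGeometry.SAW.law, MeasureTheory.Measure.smul_apply, smul_eq_mul, htop, ENNReal.inv_top,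
        zero_mul]
    · right
      refine ⟨?_⟩
      rw [Literature.Probability.RandomPlanarGeometry.SAW.law, MeasureTheory.Measure.smul_apply, smul_eq_mul, ENNReal.inv_mul_cancel h0 htop]

/-- **Along a weakly convergent subsequence the SAW laws are eventually probability measures**: testing
the weak convergence `∫ f(γ.curve) dP_(s n) → ∫ f dν` (`ν` a probability measure) on `f ≡ 1` gives
`P_(s n)(univ) → 1`, and `P_(s n)(univ) ∈ {0, 1}`. -/
theorem eventually_isProbabilityMeasure_of_tendsto (D : Literature.Probability.RandomPlanarGeometry.DobrushinDomain) (a b : ℝ → Literature.Probability.LatticeModels.Site 2)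
    {ν : MeasureTheory.Measure (Literature.Probability.RandomPlanarGeometry.CurveClass ℂ)} [MeasureTheory.IsProbabilityMeasure ν] {s : ℕ → ℝ}
    (hlim : ∀ f : BoundedContinuousFunction (Literature.Probability.RandomPlanarGeometry.CurveClass ℂ) ℝ,
      Filter.Tendsto (fun n => ∫ γ, f ((Literature.Probability.RandomPlanarGeometry.SAW.DomainSAW.curve γ)) ∂(Literature.Probability.RandomPlanarGeometry.SAW.law D.carrier (s n) (a (s n)) (b (s n)))) Filter.atTop
        (nhds (∫ c, f c ∂ν))) :
    ∀ᶠ n in Filter.atTop, MeasureTheory.IsProbabilityMeasure (Literature.Probability.RandomPlanarGeometry.SAW.law D.carrier (s n) (a (s n)) (b (s n))) := by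
  have h1 : Filter.Tendsto (fun n => (Literature.Probability.RandomPlanarGeometry.SAW.law D.carrier (s n) (a (s n)) (b (s n))).real Set.univ) Filter.atTop (nhds 1) := by
    have := hlim (BoundedContinuousFunction.const _ (1 : ℝ))
    simpa [MeasureTheory.integral_const] using this
  filter_upwards [h1.eventually (lt_mem_nhds (by norm_num : (1 / 2 : ℝ) < 1))] with n hn
  rcases saw_law_univ_eq_zero_or_isProbabilityMeasure D.carrier (s n) (a (s n)) (b (s n)) with h0 | h
  · exfalso
    rw [MeasureTheory.measureReal_def, h0, ENNReal.toReal_zero] at hn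
    norm_num at hn
  · exact h

/-- **The composition** (no `sorry` of its own): extract the mesh sequence of the subsequential limit, drop
its finitely many non-probability terms (`eventually_isProbabilityMeasure_of_tendsto`), get driver
tightness from S1, the interpolated driving paths with their joint convergence in law from S2, project to
the driving-path marginal (continuous mapping), and conclude by S3. -/
theorem correctorPassage'_of (h1 : DriverTightness) (h2 : DrivingConvergence) (h3 : StoppedPassage) :
    CorrectorPassage' := by
  intro κ D a b φ hκ hab hφ hM ν hν hsub hdesc
  obtain ⟨s, hs, hlim⟩ := hsub
  obtain ⟨N, hN⟩ := Filter.eventually_atTop.1 (eventually_isProbabilityMeasure_of_tendsto D a b (s := s) hlim)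
  have hs' : Filter.Tendsto (fun n => s (n + N)) Filter.atTop (nhdsWithin (0 : ℝ) (Set.Ioi 0)) :=
    hs.comp (Filter.tendsto_add_atTop_nat N)
  have hprob' : ∀ n, MeasureTheory.IsProbabilityMeasure
      (Literature.Probability.RandomPlanarGeometry.SAW.law D.carrier (s (n + N)) (a (s (n + N))) (b (s (n + N)))) :=
    fun n => hN (n + N) (Nat.le_add_left N n)
  have hlim' : ∀ f : BoundedContinuousFunction (Literature.Probability.RandomPlanarGeometry.CurveClass ℂ) ℝ,
      Filter.Tendsto (fun n => ∫ γ, f γ.curve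
        ∂(Literature.Probability.RandomPlanarGeometry.SAW.law D.carrier (s (n + N)) (a (s (n + N))) (b (s (n + N))))) Filter.atTop
        (nhds (∫ c, f c ∂ν)) :=
    fun f => (hlim f).comp (Filter.tendsto_add_atTop_nat N)
  obtain ⟨V, hV, hjoint⟩ :=
    h2 D a b φ hab hφ (h1 κ D a b φ hκ hab hφ hM) ν hν (fun n => s (n + N)) hs' hprob' hlim' hdesc
  refine h3 κ D a b φ hκ hab hφ hM ν hν (fun n => s (n + N)) hs' hprob' V hV ?_
  unfold DrivingLawConvergence
  unfold JointDrivingConvergence at hjoint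
  exact hjoint.continuous_comp continuous_snd

/-- **The skeleton theorem**: the three registered stubs imply the crux `CorrectorPassage` BY NAME. -/
theorem CorrectorPassage_of (h1 : __Registered.stub_driverTightness)
    (h2 : __Registered.stub_drivingConvergence) (h3 : __Registered.stub_stoppedPassage) :
    Summit.CriticalPhenomena.SAWScalingLimit.Theses.SAWTipEnvironment.CorrectorPassage :=
  correctorPassage_iff.mp (correctorPassage'_of h1 h2 h3)

/-- Wiring check (an `example`, so that `CorrectorPassage_of` stays the only theorem concluding the crux):
the registered stubs, with their stated types, feed the skeleton theorem — this term becomes the crux proof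
when the three `sorry`s above are discharged. -/
example : Summit.CriticalPhenomena.SAWScalingLimit.Theses.SAWTipEnvironment.CorrectorPassage :=
  CorrectorPassage_of stub_driverTightness stub_drivingConvergence stub_stoppedPassage

end Summit.CriticalPhenomena.SAWScalingLimit.Cruxes.CorrectorPassage.Birth

end
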